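import Mathlib
import Literature.Analysis.FluidPDE.VectorCalculus
import Summits.NavierStokesRegularity.NavierStokesRegularity.Theorems.FilamentSkeletonRssClause13RAdjointEnergy

/-!
# Clause 13-R, STUB R at MODEL level: the SOURCED waist law — `w‖φ‖` is `G`-Lipschitz-controlled across the stagnation point,
# the waist-regular branch is unique and bounded by the source alone, every other branch blows up like `1/w`
# (crux `Clause13RNearStraightL`, stmt-NavierStokesRegularity-23612; line `rate_bordered_split`, STUB R `stub_rateRow13RFlat`)

Route `FilamentSkeletonRss`, Variant A1R.  Companion of `…Clause13RAdjointWaistLaw` (homogeneous local equation, solution `C¹` THROUGH the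
waist).  The density of an annihilating measure of the model operator (`…Clause13RAdjointStraightModelWeights`, `…Clause13REdgeMeasureModel`)
solves near the stagnation point `c` (`w(c) = 0`) the SOURCED local adjoint equation
  `w σ φ′ σ + (½ + w′ σ) φ σ + α e × φ σ + cst·m σ (φ σ × d) = g σ`,
where `g` collects the (bounded, continuous) NONLOCAL term `cst·∫ k(τ−σ)(φ τ × d) dτ` and the edge-atom kernels; and a density is a priori only
`L¹`, i.e. nothing may be assumed AT `c`.  THIS FILE proves what the homogeneous, through-the-waist statements of `…AdjointWaistLaw` left as
prose (memo DIAG-23612-R-currency-leafhand19-g0.md §3 (F1)(a), "the two remaining S-sized kernel steps"):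

* `hasDerivAt_wsq_normsq_sourced` — along the sourced equation `(w²‖φ‖²)′ = −w‖φ‖² + 2w⟪g, φ⟫` (the skew terms drop exactly as before);
* `wnorm_le_of_sourced_right` — hence, where `w ≥ 0` and `‖g‖ ≤ G`, the quantity `u := w‖φ‖` obeys `u(σ₁) ≤ u(σ₀) + G(σ₁ − σ₀)` for
  `σ₀ ≤ σ₁` (proof: `s ↦ √(w²‖φ‖² + ε²) − G s` is non-increasing, then `ε ↓ 0`); mirror `wnorm_le_of_sourced_left` where `w ≤ 0`;
* `wnorm_le_of_waistRegular_right` / `_left` — on the PUNCTURED half-ball `(c, σ₁]` (solution `C¹` there only), if `w‖φ‖ → 0` at `c`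
  (WAIST-REGULAR; e.g. `φ` bounded and `w → 0`, `waistRegular_of_bounded_right`) then `w(σ)‖φ(σ)‖ ≤ G·|σ − c|`: with `w(s) ≥ κ₁(s − c)` this is
  the SUP BOUND `‖φ‖ ≤ G/κ₁` on the half-ball (`norm_le_of_waistRegular_right`) — the regular branch is bounded by the source alone;
* `eq_zero_of_waistRegular_right` / `_left` — for `g = 0` a waist-regular branch VANISHES wherever `w ≠ 0` (improper version of
  `…AdjointWaistLaw.eq_zero_of_waist_right/_left`: no regularity at `c` is used), and `waistRegular_unique_right` — two waist-regular solutions of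
  the same sourced equation coincide (the bounded branch is unique);
* `wnorm_ge_of_sourced_right` + `waist_dichotomy_right` — DICHOTOMY: on `(c, σ₁]` either `w(σ)‖φ(σ)‖ ≤ G(σ − c)` throughout (waist-regular),
  or there are `m > 0`, `σ₀` with `w‖φ‖ ≥ m` on `(c, σ₀]`, i.e. `‖φ(σ)‖ ≥ m/w(σ) ≍ m/(κ(σ − c))` — NOT integrable at the waist.
Consequence (planner-facing, memo §3): an `L¹` annihilating density of the model operator is, on each side of the waist, THE waist-regular branch,
bounded by `sup‖g‖/κ₁`; so neither singular densities nor a waist atom (which would force the `1/w` branch) enlarge the 4-parameter EDGE cokernel —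
the model-level content of «the rate row of 13-R is pure edge information».  [folklore] (Grönwall at a transport stagnation point with skew
zeroth-order part).
Hand `leafhand-ns-filamentskeletonrs-19-g0` (LAND-ONLY); `--supports stmt-NavierStokesRegularity-23612` helper, def-free.  HONEST FRAMING: ODE
estimates for the MODEL adjoint equation attached to a HYPOTHETICAL filament skeleton on the NEGATIVE side of a MODEL blow-up route; STUB R is NOT
proved here and nothing in this file bears on Navier–Stokes regularity or blow-up.
-/

noncomputable section

open MeasureTheory Filter Topology Set
open scoped RealInnerProductSpace InnerProductSpace
open Literature.Analysis.FluidPDE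
open Summit.NavierStokesRegularity.NavierStokesRegularity.Theorems.Clause13RAdjointEnergy (inner_cross_left_swap)

namespace Summit.NavierStokesRegularity.NavierStokesRegularity.Theorems.Clause13RAdjointWaistSourced
set_option linter.dupNamespace false

/-! ## §1 The pointwise identity along the SOURCED local equation -/

/-- Pairing the sourced local adjoint equation with `φ σ`: the skew terms drop and `w⟪φ′, φ⟫ = −(½ + w′)‖φ‖² + ⟪g, φ⟫`. [folklore] -/
theorem inner_deriv_of_sourced_eq {cst α : ℝ} {m w w' : ℝ → ℝ} {φ φ' g : ℝ → EuclideanSpace ℝ (Fin 3)}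
    {d e : EuclideanSpace ℝ (Fin 3)} {σ : ℝ}
    (heq : w σ • φ' σ + (1 / 2 : ℝ) • φ σ + w' σ • φ σ + α • cross e (φ σ) + (cst * m σ) • cross (φ σ) d = g σ) :
    w σ * ⟪φ' σ, φ σ⟫ = -(1 / 2 + w' σ) * ‖φ σ‖ ^ 2 + ⟪g σ, φ σ⟫ := by
  have he : ⟪cross e (φ σ), φ σ⟫ = 0 := by
    simp only [cross, cross_apply, PiLp.inner_apply, RCLike.inner_apply, conj_trivial, Fin.sum_univ_three,
      Matrix.cons_val_zero, Matrix.cons_val_one, Matrix.cons_val_two, Matrix.head_cons, Matrix.tail_cons]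
    ring
  have hd : ⟪cross (φ σ) d, φ σ⟫ = 0 := by
    have h := inner_cross_left_swap (φ σ) (φ σ) d
    linarith
  have h := congrArg (fun v => ⟪v, φ σ⟫) heq
  simp only [inner_add_left, inner_smul_left, conj_trivial, he, hd,
    real_inner_self_eq_norm_sq, mul_zero, add_zero] at h
  linarith

/-- Along the sourced local adjoint equation, `(w²‖φ‖²)′(σ) = −w(σ)‖φ(σ)‖² + 2w(σ)⟪g σ, φ σ⟫`. [folklore] -/
theorem hasDerivAt_wsq_normsq_sourced {cst α : ℝ} {m w w' : ℝ → ℝ} {φ φ' g : ℝ → EuclideanSpace ℝ (Fin 3)}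
    {d e : EuclideanSpace ℝ (Fin 3)} {σ : ℝ} (hw : HasDerivAt w (w' σ) σ) (hφ : HasDerivAt φ (φ' σ) σ)
    (heq : w σ • φ' σ + (1 / 2 : ℝ) • φ σ + w' σ • φ σ + α • cross e (φ σ) + (cst * m σ) • cross (φ σ) d = g σ) :
    HasDerivAt (fun s => w s ^ 2 * ‖φ s‖ ^ 2) (-(w σ * ‖φ σ‖ ^ 2) + 2 * w σ * ⟪g σ, φ σ⟫) σ := by
  have h1 : HasDerivAt (fun s => w s ^ 2) (2 * w σ * w' σ) σ :=
    (hw.fun_pow 2).congr_deriv (by norm_num)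
  have h2 : HasDerivAt (fun s => ‖φ s‖ ^ 2) (2 * ⟪φ σ, φ' σ⟫) σ := hφ.norm_sq
  have h3 := h1.mul h2
  have hkey := inner_deriv_of_sourced_eq heq
  have hval : 2 * w σ * w' σ * ‖φ σ‖ ^ 2 + w σ ^ 2 * (2 * ⟪φ σ, φ' σ⟫) =
      -(w σ * ‖φ σ‖ ^ 2) + 2 * w σ * ⟪g σ, φ σ⟫ := by
    have : w σ ^ 2 * (2 * ⟪φ σ, φ' σ⟫) = 2 * w σ * (w σ * ⟪φ' σ, φ σ⟫) := by rw [real_inner_comm]; ring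
    rw [this, hkey]; ring
  rw [← hval]
  exact h3

/-! ## §2 The sourced waist law: `w‖φ‖` is `G`-controlled (right of the waist, `w ≥ 0`) -/

/-- Key comparison function, right of the waist: for `ε > 0`, `s ↦ √(w(s)²‖φ(s)‖² + ε²) − G·s` is non-increasing on `[σ₀, σ₁]` when
`w ≥ 0`, `‖g‖ ≤ G` and the sourced equation holds there. [folklore] -/
theorem sqrt_wsq_normsq_antitoneOn {σ₀ σ₁ cst α G ε : ℝ} {m w w' : ℝ → ℝ} {φ φ' g : ℝ → EuclideanSpace ℝ (Fin 3)}
    {d e : EuclideanSpace ℝ (Fin 3)} (hε : 0 < ε)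
    (hw : ∀ s ∈ Icc σ₀ σ₁, HasDerivAt w (w' s) s) (hφ : ∀ s ∈ Icc σ₀ σ₁, HasDerivAt φ (φ' s) s)
    (hwnn : ∀ s ∈ Icc σ₀ σ₁, 0 ≤ w s) (hg : ∀ s ∈ Icc σ₀ σ₁, ‖g s‖ ≤ G)
    (heq : ∀ s ∈ Icc σ₀ σ₁,
      w s • φ' s + (1 / 2 : ℝ) • φ s + w' s • φ s + α • cross e (φ s) + (cst * m s) • cross (φ s) d = g s) :
    AntitoneOn (fun s => Real.sqrt (w s ^ 2 * ‖φ s‖ ^ 2 + ε ^ 2) - G * s) (Icc σ₀ σ₁) := by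
  have hcont : ContinuousOn (fun s => Real.sqrt (w s ^ 2 * ‖φ s‖ ^ 2 + ε ^ 2) - G * s) (Icc σ₀ σ₁) := by
    intro s hs
    have hwc : ContinuousAt w s := (hw s hs).continuousAt
    have hφc : ContinuousAt φ s := (hφ s hs).continuousAt
    have h : ContinuousAt (fun s => Real.sqrt (w s ^ 2 * ‖φ s‖ ^ 2 + ε ^ 2) - G * s) s :=
      (((hwc.pow 2).mul (hφc.norm.pow 2)).add continuousAt_const).sqrt.sub (continuousAt_const.mul continuousAt_id)
    exact h.continuousWithinAt
  refine antitoneOn_of_hasDerivWithinAt_nonpos (convex_Icc σ₀ σ₁) hcont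
    (f' := fun s => (-(w s * ‖φ s‖ ^ 2) + 2 * w s * ⟪g s, φ s⟫) / (2 * Real.sqrt (w s ^ 2 * ‖φ s‖ ^ 2 + ε ^ 2)) - G * 1)
    ?_ ?_
  · intro s hs
    rw [interior_Icc] at hs
    have hs' := Ioo_subset_Icc_self hs
    have hE := hasDerivAt_wsq_normsq_sourced (hw s hs') (hφ s hs') (heq s hs')
    have hpos : w s ^ 2 * ‖φ s‖ ^ 2 + ε ^ 2 ≠ 0 := by positivity
    exact (((hE.add_const (ε ^ 2)).sqrt hpos).sub ((hasDerivAt_id' s).const_mul G)).hasDerivWithinAt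
  · intro s hs
    rw [interior_Icc] at hs
    have hs' := Ioo_subset_Icc_self hs
    have hpos : 0 < w s ^ 2 * ‖φ s‖ ^ 2 + ε ^ 2 := by positivity
    have hR : 0 < Real.sqrt (w s ^ 2 * ‖φ s‖ ^ 2 + ε ^ 2) := Real.sqrt_pos.mpr hpos
    have hwφ : 0 ≤ w s * ‖φ s‖ := mul_nonneg (hwnn s hs') (norm_nonneg _)
    have hwφR : w s * ‖φ s‖ ≤ Real.sqrt (w s ^ 2 * ‖φ s‖ ^ 2 + ε ^ 2) := by
      rw [show w s ^ 2 * ‖φ s‖ ^ 2 + ε ^ 2 = (w s * ‖φ s‖) ^ 2 + ε ^ 2 by ring]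
      calc w s * ‖φ s‖ = Real.sqrt ((w s * ‖φ s‖) ^ 2) := (Real.sqrt_sq hwφ).symm
        _ ≤ Real.sqrt ((w s * ‖φ s‖) ^ 2 + ε ^ 2) := Real.sqrt_le_sqrt (by nlinarith [sq_nonneg ε])
    have hG : 0 ≤ G := (norm_nonneg _).trans (hg s hs')
    have hinner : ⟪g s, φ s⟫ ≤ G * ‖φ s‖ :=
      (real_inner_le_norm _ _).trans (mul_le_mul_of_nonneg_right (hg s hs') (norm_nonneg _))
    have h1 : 0 ≤ w s * ‖φ s‖ ^ 2 := mul_nonneg (hwnn s hs') (sq_nonneg _)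
    have h2 : w s * ⟪g s, φ s⟫ ≤ w s * (G * ‖φ s‖) := mul_le_mul_of_nonneg_left hinner (hwnn s hs')
    have h3 : G * (w s * ‖φ s‖) ≤ G * Real.sqrt (w s ^ 2 * ‖φ s‖ ^ 2 + ε ^ 2) := mul_le_mul_of_nonneg_left hwφR hG
    have hnum : -(w s * ‖φ s‖ ^ 2) + 2 * w s * ⟪g s, φ s⟫ ≤ 2 * G * Real.sqrt (w s ^ 2 * ‖φ s‖ ^ 2 + ε ^ 2) := by
      nlinarith [h1, h2, h3]
    have hdiv : (-(w s * ‖φ s‖ ^ 2) + 2 * w s * ⟪g s, φ s⟫) / (2 * Real.sqrt (w s ^ 2 * ‖φ s‖ ^ 2 + ε ^ 2)) ≤ G := by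
      rw [div_le_iff₀ (by positivity)]
      nlinarith [hnum]
    show (-(w s * ‖φ s‖ ^ 2) + 2 * w s * ⟪g s, φ s⟫) / (2 * Real.sqrt (w s ^ 2 * ‖φ s‖ ^ 2 + ε ^ 2)) - G * 1 ≤ 0
    linarith

/-- **SOURCED WAIST LAW, right of the waist (quantitative).**  If `φ ∈ C¹[σ₀, σ₁]` solves the sourced local adjoint equation there, with
`w ≥ 0` and `‖g‖ ≤ G` on `[σ₀, σ₁]`, then `w(σ₁)‖φ(σ₁)‖ ≤ w(σ₀)‖φ(σ₀)‖ + G·(σ₁ − σ₀)`. [folklore] -/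
theorem wnorm_le_of_sourced_right {σ₀ σ₁ cst α G : ℝ} {m w w' : ℝ → ℝ} {φ φ' g : ℝ → EuclideanSpace ℝ (Fin 3)}
    {d e : EuclideanSpace ℝ (Fin 3)} (hσ : σ₀ ≤ σ₁)
    (hw : ∀ s ∈ Icc σ₀ σ₁, HasDerivAt w (w' s) s) (hφ : ∀ s ∈ Icc σ₀ σ₁, HasDerivAt φ (φ' s) s)
    (hwnn : ∀ s ∈ Icc σ₀ σ₁, 0 ≤ w s) (hg : ∀ s ∈ Icc σ₀ σ₁, ‖g s‖ ≤ G)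
    (heq : ∀ s ∈ Icc σ₀ σ₁,
      w s • φ' s + (1 / 2 : ℝ) • φ s + w' s • φ s + α • cross e (φ s) + (cst * m s) • cross (φ s) d = g s) :
    w σ₁ * ‖φ σ₁‖ ≤ w σ₀ * ‖φ σ₀‖ + G * (σ₁ - σ₀) := by
  have h0 : 0 ≤ w σ₀ * ‖φ σ₀‖ := mul_nonneg (hwnn σ₀ (left_mem_Icc.2 hσ)) (norm_nonneg _)
  have h1 : 0 ≤ w σ₁ * ‖φ σ₁‖ := mul_nonneg (hwnn σ₁ (right_mem_Icc.2 hσ)) (norm_nonneg _)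
  refine le_of_forall_pos_le_add fun ε hε => ?_
  have hA := sqrt_wsq_normsq_antitoneOn hε hw hφ hwnn hg heq
  have hle : Real.sqrt (w σ₁ ^ 2 * ‖φ σ₁‖ ^ 2 + ε ^ 2) - G * σ₁ ≤ Real.sqrt (w σ₀ ^ 2 * ‖φ σ₀‖ ^ 2 + ε ^ 2) - G * σ₀ :=
    hA (left_mem_Icc.2 hσ) (right_mem_Icc.2 hσ) hσ
  have hlow : w σ₁ * ‖φ σ₁‖ ≤ Real.sqrt (w σ₁ ^ 2 * ‖φ σ₁‖ ^ 2 + ε ^ 2) := by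
    rw [show w σ₁ ^ 2 * ‖φ σ₁‖ ^ 2 + ε ^ 2 = (w σ₁ * ‖φ σ₁‖) ^ 2 + ε ^ 2 by ring]
    calc w σ₁ * ‖φ σ₁‖ = Real.sqrt ((w σ₁ * ‖φ σ₁‖) ^ 2) := (Real.sqrt_sq h1).symm
      _ ≤ Real.sqrt ((w σ₁ * ‖φ σ₁‖) ^ 2 + ε ^ 2) := Real.sqrt_le_sqrt (by nlinarith [sq_nonneg ε])
  have hup : Real.sqrt (w σ₀ ^ 2 * ‖φ σ₀‖ ^ 2 + ε ^ 2) ≤ w σ₀ * ‖φ σ₀‖ + ε :=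
    calc Real.sqrt (w σ₀ ^ 2 * ‖φ σ₀‖ ^ 2 + ε ^ 2) ≤ Real.sqrt ((w σ₀ * ‖φ σ₀‖ + ε) ^ 2) :=
          Real.sqrt_le_sqrt (by nlinarith [mul_nonneg h0 hε.le])
      _ = w σ₀ * ‖φ σ₀‖ + ε := Real.sqrt_sq (by linarith)
  linarith

/-! ## §3 At the waist, right half-ball `(c, σ₁]`: a-priori bound for the waist-regular branch, vanishing, uniqueness, sup bound -/

/-- A branch bounded near `c⁺` is WAIST-REGULAR (`w‖φ‖ → 0` at `c⁺`) as soon as `w → 0` at `c⁺`. [folklore] -/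
theorem waistRegular_of_bounded_right {c M : ℝ} {w : ℝ → ℝ} {φ : ℝ → EuclideanSpace ℝ (Fin 3)}
    (hwc : Tendsto w (𝓝[>] c) (𝓝 0)) (hM : ∀ᶠ s in 𝓝[>] c, ‖φ s‖ ≤ M) :
    Tendsto (fun s => w s * ‖φ s‖) (𝓝[>] c) (𝓝 0) := by
  refine squeeze_zero_norm' (a := fun s => |w s| * M) ?_ ?_
  · filter_upwards [hM] with s hs
    rw [norm_mul, Real.norm_eq_abs, Real.norm_eq_abs, abs_norm]
    exact mul_le_mul_of_nonneg_left hs (abs_nonneg _)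
  · simpa using hwc.abs.mul_const M

/-- **A-PRIORI BOUND for the waist-regular branch (right half-ball).**  Let `φ` solve the sourced local adjoint equation on the PUNCTURED
half-ball `(c, σ₁]` (`C¹` there — nothing is assumed AT the stagnation point), with `w ≥ 0`, `‖g‖ ≤ G` there, and let `w‖φ‖ → 0` at `c⁺`.
Then `w(σ)‖φ(σ)‖ ≤ G·(σ − c)` for every `σ ∈ (c, σ₁]`. [folklore] -/
theorem wnorm_le_of_waistRegular_right {c σ₁ cst α G : ℝ} {m w w' : ℝ → ℝ} {φ φ' g : ℝ → EuclideanSpace ℝ (Fin 3)}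
    {d e : EuclideanSpace ℝ (Fin 3)}
    (hw : ∀ s ∈ Ioc c σ₁, HasDerivAt w (w' s) s) (hφ : ∀ s ∈ Ioc c σ₁, HasDerivAt φ (φ' s) s)
    (hwnn : ∀ s ∈ Ioc c σ₁, 0 ≤ w s) (hg : ∀ s ∈ Ioc c σ₁, ‖g s‖ ≤ G)
    (heq : ∀ s ∈ Ioc c σ₁,
      w s • φ' s + (1 / 2 : ℝ) • φ s + w' s • φ s + α • cross e (φ s) + (cst * m s) • cross (φ s) d = g s)
    (hreg : Tendsto (fun s => w s * ‖φ s‖) (𝓝[>] c) (𝓝 0))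
    {σ : ℝ} (hσ : σ ∈ Ioc c σ₁) : w σ * ‖φ σ‖ ≤ G * (σ - c) := by
  have hG : 0 ≤ G := (norm_nonneg _).trans (hg σ hσ)
  have key : ∀ s ∈ Ioo c σ, w σ * ‖φ σ‖ - G * (σ - c) ≤ w s * ‖φ s‖ := by
    intro s hs
    have hsub : Icc s σ ⊆ Ioc c σ₁ := fun x hx => ⟨hs.1.trans_le hx.1, hx.2.trans hσ.2⟩
    have h := wnorm_le_of_sourced_right hs.2.le (fun x hx => hw x (hsub hx)) (fun x hx => hφ x (hsub hx))
      (fun x hx => hwnn x (hsub hx)) (fun x hx => hg x (hsub hx)) (fun x hx => heq x (hsub hx))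
    have : 0 ≤ G * (s - c) := mul_nonneg hG (sub_nonneg.2 hs.1.le)
    linarith
  have hev : ∀ᶠ s in 𝓝[>] c, w σ * ‖φ σ‖ - G * (σ - c) ≤ w s * ‖φ s‖ :=
    eventually_of_mem (Ioo_mem_nhdsGT hσ.1) key
  have h := ge_of_tendsto hreg hev
  linarith

/-- Conversely, the a-priori bound `w(σ)‖φ(σ)‖ ≤ G(σ − c)` on `(c, σ₁]` forces waist-regularity — so on a punctured half-ball
«waist-regular» and «within the regular budget `G(σ − c)`» are the same thing (no hypothesis on `w` at `c`). [folklore] -/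
theorem waistRegular_of_wnorm_le {c σ₁ G : ℝ} {w : ℝ → ℝ} {φ : ℝ → EuclideanSpace ℝ (Fin 3)} (hσ₁ : c < σ₁)
    (hwnn : ∀ s ∈ Ioc c σ₁, 0 ≤ w s) (hle : ∀ s ∈ Ioc c σ₁, w s * ‖φ s‖ ≤ G * (s - c)) :
    Tendsto (fun s => w s * ‖φ s‖) (𝓝[>] c) (𝓝 0) := by
  have hlim : Tendsto (fun s : ℝ => G * (s - c)) (𝓝[>] c) (𝓝 0) := by
    have : Tendsto (fun s : ℝ => G * (s - c)) (𝓝 c) (𝓝 (G * (c - c))) :=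
      (continuous_const.mul (continuous_id.sub continuous_const)).tendsto c
    rw [sub_self, mul_zero] at this
    exact this.mono_left nhdsWithin_le_nhds
  refine squeeze_zero' ?_ ?_ hlim
  · exact eventually_of_mem (Ioc_mem_nhdsGT hσ₁) fun s hs => mul_nonneg (hwnn s hs) (norm_nonneg _)
  · exact eventually_of_mem (Ioc_mem_nhdsGT hσ₁) hle

/-- **NO nonzero waist-regular branch of the homogeneous equation on the punctured half-ball (right)** — the improper version of
`…Clause13RAdjointWaistLaw.eq_zero_of_waist_right`: a solution of the HOMOGENEOUS local adjoint equation on `(c, σ₁]`, `C¹` there only, with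
`w ≥ 0` there and `w‖φ‖ → 0` at `c⁺` (in particular any branch bounded near the waist when `w → 0`), vanishes at every station where `w ≠ 0`.
Nonzero local branches are therefore exactly the ones with `w‖φ‖ ≥ m > 0` near `c` (see `waist_dichotomy_right`). [folklore] -/
theorem eq_zero_of_waistRegular_right {c σ₁ cst α : ℝ} {m w w' : ℝ → ℝ} {φ φ' : ℝ → EuclideanSpace ℝ (Fin 3)}
    {d e : EuclideanSpace ℝ (Fin 3)}
    (hw : ∀ s ∈ Ioc c σ₁, HasDerivAt w (w' s) s) (hφ : ∀ s ∈ Ioc c σ₁, HasDerivAt φ (φ' s) s)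
    (hwnn : ∀ s ∈ Ioc c σ₁, 0 ≤ w s)
    (heq : ∀ s ∈ Ioc c σ₁,
      w s • φ' s + (1 / 2 : ℝ) • φ s + w' s • φ s + α • cross e (φ s) + (cst * m s) • cross (φ s) d = 0)
    (hreg : Tendsto (fun s => w s * ‖φ s‖) (𝓝[>] c) (𝓝 0))
    {σ : ℝ} (hσ : σ ∈ Ioc c σ₁) (hwσ : w σ ≠ 0) : φ σ = 0 := by
  have h := wnorm_le_of_waistRegular_right (g := fun _ => 0) (G := 0) hw hφ hwnn (fun s _ => by simp)
    (fun s hs => by rw [heq s hs]) hreg hσ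
  have hwpos : 0 < w σ := lt_of_le_of_ne (hwnn σ hσ) (Ne.symm hwσ)
  have hn : ‖φ σ‖ ≤ 0 := by
    by_contra hlt
    have := mul_pos hwpos (not_le.mp hlt)
    linarith
  exact norm_eq_zero.mp (le_antisymm hn (norm_nonneg _))

/-- **UNIQUENESS of the waist-regular branch (right half-ball).**  Two solutions of the SAME sourced local adjoint equation on `(c, σ₁]`
(`C¹` there only), both waist-regular, coincide at every station where `w ≠ 0`: an `L¹`/bounded annihilating density is, right of the waist,
THE regular branch. [folklore] -/
theorem waistRegular_unique_right {c σ₁ cst α : ℝ} {m w w' : ℝ → ℝ} {φ φ' ψ ψ' g : ℝ → EuclideanSpace ℝ (Fin 3)}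
    {d e : EuclideanSpace ℝ (Fin 3)} (hσ₁ : c < σ₁)
    (hw : ∀ s ∈ Ioc c σ₁, HasDerivAt w (w' s) s) (hφ : ∀ s ∈ Ioc c σ₁, HasDerivAt φ (φ' s) s)
    (hψ : ∀ s ∈ Ioc c σ₁, HasDerivAt ψ (ψ' s) s) (hwnn : ∀ s ∈ Ioc c σ₁, 0 ≤ w s)
    (heqφ : ∀ s ∈ Ioc c σ₁,
      w s • φ' s + (1 / 2 : ℝ) • φ s + w' s • φ s + α • cross e (φ s) + (cst * m s) • cross (φ s) d = g s)
    (heqψ : ∀ s ∈ Ioc c σ₁,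
      w s • ψ' s + (1 / 2 : ℝ) • ψ s + w' s • ψ s + α • cross e (ψ s) + (cst * m s) • cross (ψ s) d = g s)
    (hregφ : Tendsto (fun s => w s * ‖φ s‖) (𝓝[>] c) (𝓝 0)) (hregψ : Tendsto (fun s => w s * ‖ψ s‖) (𝓝[>] c) (𝓝 0))
    {σ : ℝ} (hσ : σ ∈ Ioc c σ₁) (hwσ : w σ ≠ 0) : φ σ = ψ σ := by
  have hderiv : ∀ s ∈ Ioc c σ₁, HasDerivAt (fun x => φ x - ψ x) (φ' s - ψ' s) s :=
    fun s hs => (hφ s hs).sub (hψ s hs)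
  have heq : ∀ s ∈ Ioc c σ₁, w s • (φ' s - ψ' s) + (1 / 2 : ℝ) • (φ s - ψ s) + w' s • (φ s - ψ s)
      + α • cross e (φ s - ψ s) + (cst * m s) • cross (φ s - ψ s) d = 0 := by
    intro s hs
    have h1 := heqφ s hs
    have h2 := heqψ s hs
    have hc1 : cross e (φ s - ψ s) = cross e (φ s) - cross e (ψ s) := by
      simpa only [crossCLM_apply] using (crossCLM e).map_sub (φ s) (ψ s)
    have hc2 : cross (φ s - ψ s) d = cross (φ s) d - cross (ψ s) d := by
      simpa only [crossCLM_apply, sub_apply] using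
        congrArg (fun L : EuclideanSpace ℝ (Fin 3) →L[ℝ] EuclideanSpace ℝ (Fin 3) => L d)
          (crossCLM.map_sub (φ s) (ψ s))
    rw [hc1, hc2, smul_sub, smul_sub, smul_sub, smul_sub, smul_sub]
    calc w s • φ' s - w s • ψ' s + ((1 / 2 : ℝ) • φ s - (1 / 2 : ℝ) • ψ s) + (w' s • φ s - w' s • ψ s)
          + (α • cross e (φ s) - α • cross e (ψ s)) + ((cst * m s) • cross (φ s) d - (cst * m s) • cross (ψ s) d)
        = (w s • φ' s + (1 / 2 : ℝ) • φ s + w' s • φ s + α • cross e (φ s) + (cst * m s) • cross (φ s) d)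
          - (w s • ψ' s + (1 / 2 : ℝ) • ψ s + w' s • ψ s + α • cross e (ψ s) + (cst * m s) • cross (ψ s) d) := by abel
      _ = 0 := by rw [h1, h2, sub_self]
  have hreg : Tendsto (fun s => w s * ‖φ s - ψ s‖) (𝓝[>] c) (𝓝 0) := by
    refine squeeze_zero' ?_ ?_ (by simpa using hregφ.add hregψ)
    · exact eventually_of_mem (Ioc_mem_nhdsGT hσ₁) fun s hs => mul_nonneg (hwnn s hs) (norm_nonneg _)
    · refine eventually_of_mem (Ioc_mem_nhdsGT hσ₁) fun s hs => ?_
      calc w s * ‖φ s - ψ s‖ ≤ w s * (‖φ s‖ + ‖ψ s‖) := mul_le_mul_of_nonneg_left (norm_sub_le _ _) (hwnn s hs)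
        _ = w s * ‖φ s‖ + w s * ‖ψ s‖ := by ring
  have h := eq_zero_of_waistRegular_right (φ := fun x => φ x - ψ x) (φ' := fun x => φ' x - ψ' x)
    hw hderiv hwnn heq hreg hσ hwσ
  exact sub_eq_zero.mp h

/-- **SUP BOUND for the waist-regular branch (right half-ball).**  If moreover the slip opens at least linearly, `w(s) ≥ κ₁(s − c)` on
`(c, σ₁]` with `κ₁ > 0`, then `‖φ(σ)‖ ≤ G/κ₁` on `(c, σ₁]`: the waist-regular branch is BOUNDED BY THE SOURCE ALONE (no datum at any
station enters). [folklore] -/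
theorem norm_le_of_waistRegular_right {c σ₁ cst α G κ₁ : ℝ} {m w w' : ℝ → ℝ} {φ φ' g : ℝ → EuclideanSpace ℝ (Fin 3)}
    {d e : EuclideanSpace ℝ (Fin 3)} (hκ : 0 < κ₁) (hwlow : ∀ s ∈ Ioc c σ₁, κ₁ * (s - c) ≤ w s)
    (hw : ∀ s ∈ Ioc c σ₁, HasDerivAt w (w' s) s) (hφ : ∀ s ∈ Ioc c σ₁, HasDerivAt φ (φ' s) s)
    (hg : ∀ s ∈ Ioc c σ₁, ‖g s‖ ≤ G)
    (heq : ∀ s ∈ Ioc c σ₁,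
      w s • φ' s + (1 / 2 : ℝ) • φ s + w' s • φ s + α • cross e (φ s) + (cst * m s) • cross (φ s) d = g s)
    (hreg : Tendsto (fun s => w s * ‖φ s‖) (𝓝[>] c) (𝓝 0))
    {σ : ℝ} (hσ : σ ∈ Ioc c σ₁) : ‖φ σ‖ ≤ G / κ₁ := by
  have hwnn : ∀ s ∈ Ioc c σ₁, 0 ≤ w s :=
    fun s hs => (mul_nonneg hκ.le (sub_nonneg.2 hs.1.le)).trans (hwlow s hs)
  have h := wnorm_le_of_waistRegular_right hw hφ hwnn hg heq hreg hσ
  have hsc : 0 < σ - c := sub_pos.2 hσ.1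
  have h2 : κ₁ * (σ - c) * ‖φ σ‖ ≤ w σ * ‖φ σ‖ := mul_le_mul_of_nonneg_right (hwlow σ hσ) (norm_nonneg _)
  rw [le_div_iff₀ hκ]
  nlinarith [h2, h, hsc, norm_nonneg (φ σ)]

/-! ## §4 The blow-up alternative and the dichotomy (right half-ball) -/

/-- **Lower bound going INTO the waist (right half-ball).**  For a solution on `(c, σ₁]` (`w ≥ 0`, `‖g‖ ≤ G`):
`w(σ)‖φ(σ)‖ ≥ w(σ₁)‖φ(σ₁)‖ − G(σ₁ − c)` for every `σ ∈ (c, σ₁]`.  So a branch that exceeds the regular budget at ONE station,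
`w(σ₁)‖φ(σ₁)‖ > G(σ₁ − c)`, satisfies `‖φ(σ)‖ ≥ m/w(σ)` all the way into the waist (`m > 0`): for a slip `w(σ) ≤ κ₂(σ − c)` this is
`≥ m/(κ₂(σ − c))`, NOT integrable at `c` — such a branch carries no finite measure. [folklore] -/
theorem wnorm_ge_of_sourced_right {c σ₁ cst α G : ℝ} {m w w' : ℝ → ℝ} {φ φ' g : ℝ → EuclideanSpace ℝ (Fin 3)}
    {d e : EuclideanSpace ℝ (Fin 3)}
    (hw : ∀ s ∈ Ioc c σ₁, HasDerivAt w (w' s) s) (hφ : ∀ s ∈ Ioc c σ₁, HasDerivAt φ (φ' s) s)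
    (hwnn : ∀ s ∈ Ioc c σ₁, 0 ≤ w s) (hg : ∀ s ∈ Ioc c σ₁, ‖g s‖ ≤ G)
    (heq : ∀ s ∈ Ioc c σ₁,
      w s • φ' s + (1 / 2 : ℝ) • φ s + w' s • φ s + α • cross e (φ s) + (cst * m s) • cross (φ s) d = g s)
    {σ : ℝ} (hσ : σ ∈ Ioc c σ₁) : w σ₁ * ‖φ σ₁‖ - G * (σ₁ - c) ≤ w σ * ‖φ σ‖ := by
  have hG : 0 ≤ G := (norm_nonneg _).trans (hg σ hσ)
  have hsub : Icc σ σ₁ ⊆ Ioc c σ₁ := fun x hx => ⟨hσ.1.trans_le hx.1, hx.2⟩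
  have h := wnorm_le_of_sourced_right hσ.2 (fun x hx => hw x (hsub hx)) (fun x hx => hφ x (hsub hx))
    (fun x hx => hwnn x (hsub hx)) (fun x hx => hg x (hsub hx)) (fun x hx => heq x (hsub hx))
  have : 0 ≤ G * (σ - c) := mul_nonneg hG (sub_nonneg.2 hσ.1.le)
  linarith

/-- **WAIST DICHOTOMY (right half-ball).**  A solution of the sourced local adjoint equation on the punctured half-ball `(c, σ₁]`
(`C¹` there only, `w ≥ 0`, `‖g‖ ≤ G`) is EITHER within the regular budget at every station, `w(σ)‖φ(σ)‖ ≤ G(σ − c)` on `(c, σ₁]`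
(⟺ waist-regular, `waistRegular_of_wnorm_le`; then unique and, for `w ≥ κ₁(σ − c)`, bounded by `G/κ₁`), OR there are `m > 0` and a station
`σ₀ ∈ (c, σ₁]` with `w(σ)‖φ(σ)‖ ≥ m` on all of `(c, σ₀]` (blow-up `≥ m/w`, non-integrable at the waist).  There is no third kind of local
branch. [folklore] -/
theorem waist_dichotomy_right {c σ₁ cst α G : ℝ} {m w w' : ℝ → ℝ} {φ φ' g : ℝ → EuclideanSpace ℝ (Fin 3)}
    {d e : EuclideanSpace ℝ (Fin 3)}
    (hw : ∀ s ∈ Ioc c σ₁, HasDerivAt w (w' s) s) (hφ : ∀ s ∈ Ioc c σ₁, HasDerivAt φ (φ' s) s)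
    (hwnn : ∀ s ∈ Ioc c σ₁, 0 ≤ w s) (hg : ∀ s ∈ Ioc c σ₁, ‖g s‖ ≤ G)
    (heq : ∀ s ∈ Ioc c σ₁,
      w s • φ' s + (1 / 2 : ℝ) • φ s + w' s • φ s + α • cross e (φ s) + (cst * m s) • cross (φ s) d = g s) :
    (∀ σ ∈ Ioc c σ₁, w σ * ‖φ σ‖ ≤ G * (σ - c)) ∨
      ∃ m₀ : ℝ, 0 < m₀ ∧ ∃ σ₀ ∈ Ioc c σ₁, ∀ σ ∈ Ioc c σ₀, m₀ ≤ w σ * ‖φ σ‖ := by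
  by_cases h : ∀ σ ∈ Ioc c σ₁, w σ * ‖φ σ‖ ≤ G * (σ - c)
  · exact Or.inl h
  · push Not at h
    obtain ⟨σ₀, hσ₀, hlt⟩ := h
    refine Or.inr ⟨w σ₀ * ‖φ σ₀‖ - G * (σ₀ - c), by linarith, σ₀, hσ₀, fun σ hσ => ?_⟩
    have hsub : Ioc c σ₀ ⊆ Ioc c σ₁ := fun x hx => ⟨hx.1, hx.2.trans hσ₀.2⟩
    exact wnorm_ge_of_sourced_right (fun x hx => hw x (hsub hx)) (fun x hx => hφ x (hsub hx))
      (fun x hx => hwnn x (hsub hx)) (fun x hx => hg x (hsub hx)) (fun x hx => heq x (hsub hx)) hσ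

end Summit.NavierStokesRegularity.NavierStokesRegularity.Theorems.Clause13RAdjointWaistSourced

end
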